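import Mathlib
import Summits.ValiantsHypothesis.ValiantsHypothesis.Theses.ValuativeGCT
import Summits.ValiantsHypothesis.ValiantsHypothesis.Theorems.ValuativeGCTValuativeFlipFirstRungBiteCentres

/-!
# `ValuativeGCT.ValuativeFlip` (stmt-ValiantsHypothesis-12624), det census — the first-rung bite along the
# route's EVEN candidate `Λ_{m-1} ⊕ E_{mm}` (every even `m ≥ 4`), with admissibility

Companion of `ValuativeGCTValuativeFlipFirstRungBite{,Centres}`.  The route `ValuativeGCT` records "NOT DECOMPOSED
YET: the choice of `U` for even `m` (`Λ_(m-1) ⊕ E_mm` or another full-ncrk singular space)"; its kill criteria ask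
whether the cut is vacuous for "the other Edmonds-gap candidates (`Λ_(m-1) ⊕ E_mm`, …)".  Answer at the first rung:

* `firstRung_bite_evenCentre` — for every even `m ≥ 4`, along `U = Λ_{m-1} ⊕ E_{mm}` (skew off the last index, zero on
  the last row and column off the corner) some `λ ⊢ 2m` (`≤ m²` parts) has `finrank T_U(t, λ*) < finrank T_U(0, λ*)`
  for every `t ≥ 1` — `firstRung_bite_of_mem` along the even placement
  `Fin 3 ⊕ ((Fin 2 × Fin k) ⊕ Fin 1) ≃ Fin (3 + 2k + 1)` with block `Y = J_{2k} ⊕ 1` (`det = 1`);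
* `evenCentre_rank_le` — the centre is admissible with `r = m - 1` (Laplace along the last row leaves
  `u_mm · det(odd skew) = 0`);
* `firstRung_evenCentre_admissible_bites` — both together in the crux's currency: threshold `2 (m - r) = 2`.

References: BLMW, SIAM J. Comput. 40 (2011) §5.2; M. Domokos, A. N. Zubkov, Transform. Groups 6 (2001) Thm. 1.1.
-/

namespace Summit.ValiantsHypothesis.ValiantsHypothesis.Theorems.ValuativeFlip

open Literature.NumberTheory.DiophantineGeometry Literature.Computability.AlgebraicComplexity
open MvPolynomial
open scoped BigOperators Matrix Kronecker

-- `Summit.ValiantsHypothesis.ValiantsHypothesis.…` is the tree's mandated single-conjunct layout (Sub = Summit).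
set_option linter.dupNamespace false

noncomputable section

/-! ### §3b The route's even candidate `Λ_{m-1} ⊕ E_{mm}` — every even `m ≥ 4` -/

/-- Splitting an index of `Fin (3 + 2k + 1)` along the even placement
`e = (sumAssoc.symm).trans ((e_odd ⊕ 1).trans finSumFinEquiv)`: a letter, a symplectic-block index, or the last index.
[folklore] -/
theorem frc_even_split (k : ℕ) (a : Fin (3 + 2 * k + 1)) :
    (∃ i : Fin 3, a = Fin.castSucc (Fin.castAdd (2 * k) i)) ∨
    (∃ x : Fin 2 × Fin k, a = Fin.castSucc (Fin.natAdd 3 (finProdFinEquiv x))) ∨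
    a = Fin.last (3 + 2 * k) := by
  rcases Fin.eq_castSucc_or_eq_last a with ⟨a', rfl⟩ | rfl
  · rcases frc_fin_split (2 * k) a' with ⟨i, rfl⟩ | ⟨j, rfl⟩
    · exact Or.inl ⟨i, rfl⟩
    · refine Or.inr (Or.inl ⟨finProdFinEquiv.symm j, ?_⟩)
      rw [Equiv.apply_symm_apply]
  · exact Or.inr (Or.inr rfl)

/-- The even placement evaluated: letters. [folklore] -/
theorem frc_evenPlace_inl (k : ℕ) (i : Fin 3) :
    ((Equiv.sumAssoc (Fin 3) (Fin 2 × Fin k) (Fin 1)).symm.trans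
        ((Equiv.sumCongr ((Equiv.sumCongr (Equiv.refl (Fin 3)) finProdFinEquiv).trans finSumFinEquiv)
          (Equiv.refl (Fin 1))).trans finSumFinEquiv)) (Sum.inl i) = Fin.castSucc (Fin.castAdd (2 * k) i) := by
  simp [Equiv.sumAssoc, Fin.castSucc]

/-- The even placement evaluated: symplectic block. [folklore] -/
theorem frc_evenPlace_inr_inl (k : ℕ) (x : Fin 2 × Fin k) :
    ((Equiv.sumAssoc (Fin 3) (Fin 2 × Fin k) (Fin 1)).symm.trans
        ((Equiv.sumCongr ((Equiv.sumCongr (Equiv.refl (Fin 3)) finProdFinEquiv).trans finSumFinEquiv)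
          (Equiv.refl (Fin 1))).trans finSumFinEquiv)) (Sum.inr (Sum.inl x)) =
      Fin.castSucc (Fin.natAdd 3 (finProdFinEquiv x)) := by
  simp [Equiv.sumAssoc, Fin.castSucc]

/-- The even placement evaluated: the last index. [folklore] -/
theorem frc_evenPlace_inr_inr (k : ℕ) (o : Fin 1) :
    ((Equiv.sumAssoc (Fin 3) (Fin 2 × Fin k) (Fin 1)).symm.trans
        ((Equiv.sumCongr ((Equiv.sumCongr (Equiv.refl (Fin 3)) finProdFinEquiv).trans finSumFinEquiv)
          (Equiv.refl (Fin 1))).trans finSumFinEquiv)) (Sum.inr (Sum.inr o)) = Fin.last (3 + 2 * k) := by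
  have ho : o = 0 := Subsingleton.elim _ _
  subst ho
  simp [Equiv.sumAssoc]
  rfl

/-- Rows of the shape `A ⊕ (J ⊕ c)` along the even placement (with `A` skew on the letters, `J = σ ⊗ 1_k` the
symplectic block, `c` a scalar in the corner, or zero blocks) lie in the route's even candidate centre
`Λ_{m-1} ⊕ E_{mm} = span {u | u skew off the last index, u zero on the last row and column off the corner}`. [folklore] -/
theorem frc_mem_evenCentre {k : ℕ} {A : Matrix (Fin 3) (Fin 3) ℂ} {D : Matrix ((Fin 2 × Fin k) ⊕ Fin 1) ((Fin 2 × Fin k) ⊕ Fin 1) ℂ}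
    (hA : ∀ i j, A i j = -A j i) (hD : ∀ x y : Fin 2 × Fin k, D (Sum.inl x) (Sum.inl y) = -D (Sum.inl y) (Sum.inl x))
    (hD₁ : ∀ (x : Fin 2 × Fin k) (o : Fin 1), D (Sum.inl x) (Sum.inr o) = 0 ∧ D (Sum.inr o) (Sum.inl x) = 0) :
    (fun idx : MatIdx (3 + 2 * k + 1) => Matrix.reindex
        ((Equiv.sumAssoc (Fin 3) (Fin 2 × Fin k) (Fin 1)).symm.trans
          ((Equiv.sumCongr ((Equiv.sumCongr (Equiv.refl (Fin 3)) finProdFinEquiv).trans finSumFinEquiv)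
            (Equiv.refl (Fin 1))).trans finSumFinEquiv))
        ((Equiv.sumAssoc (Fin 3) (Fin 2 × Fin k) (Fin 1)).symm.trans
          ((Equiv.sumCongr ((Equiv.sumCongr (Equiv.refl (Fin 3)) finProdFinEquiv).trans finSumFinEquiv)
            (Equiv.refl (Fin 1))).trans finSumFinEquiv))
        (Matrix.fromBlocks A 0 0 D) (ofLex idx).1 (ofLex idx).2) ∈
      Submodule.span ℂ {u : MatIdx (3 + 2 * k + 1) → ℂ |
        (∀ a b : Fin (3 + 2 * k + 1), (a : ℕ) + 1 < 3 + 2 * k + 1 → (b : ℕ) + 1 < 3 + 2 * k + 1 →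
          u (toLex (a, b)) = -u (toLex (b, a))) ∧
        (∀ a b : Fin (3 + 2 * k + 1), (a : ℕ) + 1 = 3 + 2 * k + 1 → (b : ℕ) + 1 < 3 + 2 * k + 1 →
          u (toLex (a, b)) = 0 ∧ u (toLex (b, a)) = 0)} := by
  set e := (Equiv.sumAssoc (Fin 3) (Fin 2 × Fin k) (Fin 1)).symm.trans
    ((Equiv.sumCongr ((Equiv.sumCongr (Equiv.refl (Fin 3)) finProdFinEquiv).trans finSumFinEquiv)
      (Equiv.refl (Fin 1))).trans finSumFinEquiv) with he
  have hent : ∀ z w, Matrix.reindex e e (Matrix.fromBlocks A 0 0 D) (e z) (e w) = Matrix.fromBlocks A 0 0 D z w := by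
    intro z w
    simp only [Matrix.reindex_apply, Matrix.submatrix_apply, Equiv.symm_apply_apply]
  have hlast : ∀ o : Fin 1, ((e (Sum.inr (Sum.inr o)) : Fin (3 + 2 * k + 1)) : ℕ) = 3 + 2 * k := by
    intro o; rw [he, frc_evenPlace_inr_inr]; simp
  have hinl : ∀ i : Fin 3, ((e (Sum.inl i) : Fin (3 + 2 * k + 1)) : ℕ) = i := by
    intro i; rw [he, frc_evenPlace_inl]; simp
  have hinrl : ∀ x : Fin 2 × Fin k, ((e (Sum.inr (Sum.inl x)) : Fin (3 + 2 * k + 1)) : ℕ) = 3 + (finProdFinEquiv x : ℕ) := by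
    intro x; rw [he, frc_evenPlace_inr_inl]; simp
  refine Submodule.subset_span ⟨?_, ?_⟩
  · intro a b ha hb
    obtain ⟨z, rfl⟩ := e.surjective a
    obtain ⟨w, rfl⟩ := e.surjective b
    simp only [ofLex_toLex, hent]
    rcases z with i | x | o
    · rcases w with i' | x' | o'
      · exact hA i i'
      · simp [Matrix.fromBlocks]
      · simp [Matrix.fromBlocks]
    · rcases w with i' | x' | o'
      · simp [Matrix.fromBlocks]
      · exact hD x x'
      · exfalso; rw [hlast] at hb; omega
    · exfalso; rw [hlast] at ha; omega
  · intro a b ha hb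
    obtain ⟨z, rfl⟩ := e.surjective a
    obtain ⟨w, rfl⟩ := e.surjective b
    simp only [ofLex_toLex, hent]
    rcases z with i | x | o
    · exfalso; rw [hinl] at ha; have := i.isLt; omega
    · exfalso; rw [hinrl] at ha; have := (finProdFinEquiv x).isLt; omega
    · rcases w with i' | x' | o'
      · simp [Matrix.fromBlocks]
      · exact ⟨(hD₁ x' o).2, (hD₁ x' o).1⟩
      · exfalso; rw [hlast] at hb; omega

/-- Vectors in the even centre satisfy its two (linear) defining conditions. [folklore] -/
theorem frc_cond_of_mem_evenCentre {n : ℕ} {u : MatIdx (n + 1) → ℂ}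
    (hu : u ∈ Submodule.span ℂ {u : MatIdx (n + 1) → ℂ |
        (∀ a b : Fin (n + 1), (a : ℕ) + 1 < n + 1 → (b : ℕ) + 1 < n + 1 → u (toLex (a, b)) = -u (toLex (b, a))) ∧
        (∀ a b : Fin (n + 1), (a : ℕ) + 1 = n + 1 → (b : ℕ) + 1 < n + 1 →
          u (toLex (a, b)) = 0 ∧ u (toLex (b, a)) = 0)}) :
    (∀ a b : Fin (n + 1), (a : ℕ) + 1 < n + 1 → (b : ℕ) + 1 < n + 1 → u (toLex (a, b)) = -u (toLex (b, a))) ∧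
    (∀ a b : Fin (n + 1), (a : ℕ) + 1 = n + 1 → (b : ℕ) + 1 < n + 1 →
      u (toLex (a, b)) = 0 ∧ u (toLex (b, a)) = 0) := by
  induction hu using Submodule.span_induction with
  | mem x hx => exact hx
  | zero => exact ⟨fun _ _ _ _ => by simp, fun _ _ _ _ => by simp⟩
  | add x y _ _ hx hy =>
      refine ⟨fun a b ha hb => ?_, fun a b ha hb => ?_⟩
      · rw [Pi.add_apply, Pi.add_apply, hx.1 a b ha hb, hy.1 a b ha hb]; ring
      · rw [Pi.add_apply, Pi.add_apply, (hx.2 a b ha hb).1, (hy.2 a b ha hb).1, (hx.2 a b ha hb).2,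
          (hy.2 a b ha hb).2, add_zero]
        exact ⟨rfl, rfl⟩
  | smul c x _ hx =>
      refine ⟨fun a b ha hb => ?_, fun a b ha hb => ?_⟩
      · rw [Pi.smul_apply, Pi.smul_apply, hx.1 a b ha hb]; simp
      · rw [Pi.smul_apply, Pi.smul_apply, (hx.2 a b ha hb).1, (hx.2 a b ha hb).2, smul_zero]
        exact ⟨rfl, rfl⟩

/-- **`Λ_{m-1} ⊕ E_{mm}` is admissible with `r = m - 1` when `m - 1` is odd**: Laplace expansion along the last row
leaves `u_{mm} · det(skew of odd size) = 0`. [folklore] -/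
theorem evenCentre_rank_le {n : ℕ} (hn : Odd n) :
    ∀ u ∈ Submodule.span ℂ {u : MatIdx (n + 1) → ℂ |
        (∀ a b : Fin (n + 1), (a : ℕ) + 1 < n + 1 → (b : ℕ) + 1 < n + 1 → u (toLex (a, b)) = -u (toLex (b, a))) ∧
        (∀ a b : Fin (n + 1), (a : ℕ) + 1 = n + 1 → (b : ℕ) + 1 < n + 1 →
          u (toLex (a, b)) = 0 ∧ u (toLex (b, a)) = 0)},
      (Matrix.of fun a b : Fin (n + 1) => u (toLex (a, b))).rank ≤ n + 1 - 1 := by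
  intro u hu
  obtain ⟨h1, h2⟩ := frc_cond_of_mem_evenCentre hu
  refine frc_rank_le_of_det_eq_zero _ ?_
  rw [Matrix.det_succ_row _ (Fin.last n), Finset.sum_eq_single (Fin.last n)]
  · have hminor : ((Matrix.of fun a b : Fin (n + 1) => u (toLex (a, b))).submatrix
        (Fin.last n).succAbove (Fin.last n).succAbove).det = 0 := by
      refine frc_det_eq_zero_of_skew hn _ fun a b => ?_
      simp only [Matrix.submatrix_apply, Fin.succAbove_last, Matrix.of_apply]
      exact h1 _ _ (by simp [a.isLt]) (by simp [b.isLt])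
    rw [hminor, mul_zero]
  · intro b _ hb
    have hb' : (b : ℕ) + 1 < n + 1 := by
      have := Fin.val_lt_last hb
      omega
    rw [Matrix.of_apply, (h2 (Fin.last n) b (by simp) hb').1, mul_zero, zero_mul]
  · intro h; exact absurd (Finset.mem_univ _) h

/-- **The cut bites at the first rung along the route's even candidate `Λ_{m-1} ⊕ E_{mm}`, for every even
`m ≥ 4`.**  There is `λ ⊢ 2m` (`≤ m²` parts) with `finrank T_U(t, λ*) < finrank T_U(0, λ*)` for every `t ≥ 1`.
Certificate: `firstRung_bite_of_mem` along the even placement with `κ = (Fin 2 × Fin k) ⊕ Fin 1`,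
`m = 3 + 2k + 1`, `Y = J_{2k} ⊕ 1` (`det = 1`).  This settles positively the route's "choice of `U` for even `m`"
at the first rung. [folklore] -/
theorem firstRung_bite_evenCentre (m : ℕ) (hm : Even m) (h4 : 4 ≤ m) :
    ∃ lam : Nat.Partition (m * 2), lam.parts.card ≤ m * m ∧
      (let U : Submodule ℂ (MatIdx m → ℂ) :=
        Submodule.span ℂ {u : MatIdx m → ℂ |
          (∀ a b : Fin m, (a : ℕ) + 1 < m → (b : ℕ) + 1 < m → u (toLex (a, b)) = -u (toLex (b, a))) ∧
          (∀ a b : Fin m, (a : ℕ) + 1 = m → (b : ℕ) + 1 < m → u (toLex (a, b)) = 0 ∧ u (toLex (b, a)) = 0)};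
      let χ : Weight (MatIdx m) := (Weight.dualOfPartition (m * m) lam).toMatIdx;
      let T : ℕ → Submodule ℂ (MvPolynomial (MatIdx m × MatIdx m) ℂ) := fun t =>
        MvPolynomial.homogeneousSubmodule (MatIdx m × MatIdx m) ℂ (m * 2)
        ⊓ ((MvPolynomial.vanishingIdeal ℂ {p : MatIdx m × MatIdx m → ℂ |
              ∀ j : MatIdx m, (fun i => p (j, i)) ∈ U}) ^ (t)).restrictScalars ℂ
        ⊓ (⨅ (M : Matrix (MatIdx m) (MatIdx m) ℂ)
            (_ : linSubst (MatIdx m) ℂ M (detFormLex ℂ m) = detFormLex ℂ m),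
            LinearMap.ker ((MvPolynomial.aeval (R := ℂ) fun p : MatIdx m × MatIdx m =>
              ∑ l : MatIdx m, M l p.2 • MvPolynomial.X (p.1, l)).toLinearMap
              - LinearMap.id (R := ℂ) (M := MvPolynomial (MatIdx m × MatIdx m) ℂ)))
        ⊓ (⨅ (g : Matrix.GeneralLinearGroup (MatIdx m) ℂ) (_ : IsUpperTriangular g),
            LinearMap.ker ((MvPolynomial.aeval (R := ℂ) fun p : MatIdx m × MatIdx m =>
              ∑ l : MatIdx m, ((g⁻¹ : Matrix.GeneralLinearGroup (MatIdx m) ℂ) :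
                Matrix (MatIdx m) (MatIdx m) ℂ) p.1 l • MvPolynomial.X (l, p.2)).toLinearMap
              - weightChar χ g • LinearMap.id (R := ℂ) (M := MvPolynomial (MatIdx m × MatIdx m) ℂ)));
      ∀ t : ℕ, 0 < t → Module.finrank ℂ ↥(T t) < Module.finrank ℂ ↥(T 0)) := by
  obtain ⟨r, hr⟩ := hm
  obtain ⟨k, rfl⟩ : ∃ k, m = 3 + 2 * k + 1 := ⟨r - 2, by omega⟩
  set e := (Equiv.sumAssoc (Fin 3) (Fin 2 × Fin k) (Fin 1)).symm.trans
    ((Equiv.sumCongr ((Equiv.sumCongr (Equiv.refl (Fin 3)) finProdFinEquiv).trans finSumFinEquiv)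
      (Equiv.refl (Fin 1))).trans finSumFinEquiv) with he
  set J : Matrix (Fin 2 × Fin k) (Fin 2 × Fin k) ℂ :=
    (!![0, 1; -1, 0] : Matrix (Fin 2) (Fin 2) ℂ) ⊗ₖ (1 : Matrix (Fin k) (Fin k) ℂ) with hJ
  set Y : Matrix ((Fin 2 × Fin k) ⊕ Fin 1) ((Fin 2 × Fin k) ⊕ Fin 1) ℂ := Matrix.fromBlocks J 0 0 1 with hY
  have hYdet : Y.det ≠ 0 := by
    rw [hY, Matrix.det_fromBlocks_zero₂₁, Matrix.det_one, mul_one, hJ, frc_J_det]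
    exact one_ne_zero
  have hA : ∀ (A : Matrix (Fin 3) (Fin 3) ℂ), Aᵀ = -A → ∀ i j, A i j = -A j i := fun A hA i j => by
    have := congr_fun (congr_fun hA j) i
    simpa only [Matrix.transpose_apply, Matrix.neg_apply] using this
  have hJskew : ∀ x y : Fin 2 × Fin k, J x y = -J y x := fun x y => by
    have := congr_fun (congr_fun (frc_J_transpose k) y) x
    simpa only [Matrix.transpose_apply, Matrix.neg_apply] using this
  have hz3 : ∀ i j : Fin 3, (0 : Matrix (Fin 3) (Fin 3) ℂ) i j = -(0 : Matrix (Fin 3) (Fin 3) ℂ) j i := by simp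
  have hD0 : ∀ x y : Fin 2 × Fin k, (0 : Matrix ((Fin 2 × Fin k) ⊕ Fin 1) ((Fin 2 × Fin k) ⊕ Fin 1) ℂ) (Sum.inl x) (Sum.inl y)
      = -(0 : Matrix ((Fin 2 × Fin k) ⊕ Fin 1) ((Fin 2 × Fin k) ⊕ Fin 1) ℂ) (Sum.inl y) (Sum.inl x) := by simp
  have hD0' : ∀ (x : Fin 2 × Fin k) (o : Fin 1),
      (0 : Matrix ((Fin 2 × Fin k) ⊕ Fin 1) ((Fin 2 × Fin k) ⊕ Fin 1) ℂ) (Sum.inl x) (Sum.inr o) = 0 ∧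
      (0 : Matrix ((Fin 2 × Fin k) ⊕ Fin 1) ((Fin 2 × Fin k) ⊕ Fin 1) ℂ) (Sum.inr o) (Sum.inl x) = 0 := fun _ _ => ⟨rfl, rfl⟩
  have hYD : ∀ x y : Fin 2 × Fin k, Y (Sum.inl x) (Sum.inl y) = -Y (Sum.inl y) (Sum.inl x) := fun x y => by
    simp only [hY, Matrix.fromBlocks_apply₁₁]; exact hJskew x y
  have hYD' : ∀ (x : Fin 2 × Fin k) (o : Fin 1), Y (Sum.inl x) (Sum.inr o) = 0 ∧ Y (Sum.inr o) (Sum.inl x) = 0 :=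
    fun x o => by simp [hY]
  obtain ⟨lam, hcard, hlt⟩ := firstRung_bite_of_mem e Y hYdet _
    (frc_mem_evenCentre (hA _ frc_sP_transpose) hD0 hD0') (frc_mem_evenCentre (hA _ frc_sQ_transpose) hD0 hD0')
    (frc_mem_evenCentre (hA _ frc_sR_transpose) hD0 hD0') (frc_mem_evenCentre hz3 hYD hYD')
  exact ⟨lam, hcard, hlt⟩

/-- **The route's even candidate in the crux's currency.**  For every even `m ≥ 4`: the centre `Λ_{m-1} ⊕ E_{mm}` is
admissible with `r = m - 1` (`evenCentre_rank_le`) and, for some `λ ⊢ m · 2` (`≤ m²` parts), its valuative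
truncation at the crux's threshold `2 (m - r) = 2` is strictly below the census space:
`finrank T_U(2(m-r), λ*) < finrank T_U(0, λ*)`. [folklore] -/
theorem firstRung_evenCentre_admissible_bites (m : ℕ) (hm : Even m) (h4 : 4 ≤ m) :
    ∃ lam : Nat.Partition (m * 2), lam.parts.card ≤ m * m ∧
      (let U : Submodule ℂ (MatIdx m → ℂ) :=
        Submodule.span ℂ {u : MatIdx m → ℂ |
          (∀ a b : Fin m, (a : ℕ) + 1 < m → (b : ℕ) + 1 < m → u (toLex (a, b)) = -u (toLex (b, a))) ∧
          (∀ a b : Fin m, (a : ℕ) + 1 = m → (b : ℕ) + 1 < m → u (toLex (a, b)) = 0 ∧ u (toLex (b, a)) = 0)};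
      let χ : Weight (MatIdx m) := (Weight.dualOfPartition (m * m) lam).toMatIdx;
      let T : ℕ → Submodule ℂ (MvPolynomial (MatIdx m × MatIdx m) ℂ) := fun t =>
        MvPolynomial.homogeneousSubmodule (MatIdx m × MatIdx m) ℂ (m * 2)
        ⊓ ((MvPolynomial.vanishingIdeal ℂ {p : MatIdx m × MatIdx m → ℂ |
              ∀ j : MatIdx m, (fun i => p (j, i)) ∈ U}) ^ (t)).restrictScalars ℂ
        ⊓ (⨅ (M : Matrix (MatIdx m) (MatIdx m) ℂ)
            (_ : linSubst (MatIdx m) ℂ M (detFormLex ℂ m) = detFormLex ℂ m),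
            LinearMap.ker ((MvPolynomial.aeval (R := ℂ) fun p : MatIdx m × MatIdx m =>
              ∑ l : MatIdx m, M l p.2 • MvPolynomial.X (p.1, l)).toLinearMap
              - LinearMap.id (R := ℂ) (M := MvPolynomial (MatIdx m × MatIdx m) ℂ)))
        ⊓ (⨅ (g : Matrix.GeneralLinearGroup (MatIdx m) ℂ) (_ : IsUpperTriangular g),
            LinearMap.ker ((MvPolynomial.aeval (R := ℂ) fun p : MatIdx m × MatIdx m =>
              ∑ l : MatIdx m, ((g⁻¹ : Matrix.GeneralLinearGroup (MatIdx m) ℂ) :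
                Matrix (MatIdx m) (MatIdx m) ℂ) p.1 l • MvPolynomial.X (l, p.2)).toLinearMap
              - weightChar χ g • LinearMap.id (R := ℂ) (M := MvPolynomial (MatIdx m × MatIdx m) ℂ)));
      (∀ u ∈ U, (Matrix.of fun a b : Fin m => u (toLex (a, b))).rank ≤ m - 1) ∧
      Module.finrank ℂ ↥(T (2 * (m - (m - 1)))) < Module.finrank ℂ ↥(T 0)) := by
  obtain ⟨lam, hcard, hlt⟩ := firstRung_bite_evenCentre m hm h4
  obtain ⟨r, hr⟩ := hm
  obtain ⟨n, rfl⟩ : ∃ n, m = n + 1 := ⟨m - 1, by omega⟩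
  have hn : Odd n := ⟨r - 1, by omega⟩
  refine ⟨lam, hcard, ?_⟩
  dsimp only at hlt ⊢
  have h2 : 2 * (n + 1 - (n + 1 - 1)) = 2 := by omega
  rw [h2]
  exact ⟨evenCentre_rank_le hn, hlt 2 two_pos⟩

end

end Summit.ValiantsHypothesis.ValiantsHypothesis.Theorems.ValuativeFlip
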